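import Literature.MathematicalPhysics.QuantumFieldTheory.Balaban1983to89.B15Chi175LargeFieldFactor
import Literature.MathematicalPhysics.QuantumFieldTheory.Balaban1983to89.B11Thm1CarrierTLevelZero

/-!
# YM-DAG node N21 (= NE7c), in-edge N12 «[B15] p. 193 template» AT NODE 00's MINIMISER OF RECORD: the regularity-transfer
# binder `hreg` of `B15Chi175LargeFieldFactor` (p409091) DISCHARGED BY NAME from N07's Theorem-1 slot read at objects
# (`B11Thm1CarrierT.varProblemT`, `objects_of_thm1Printed`) and NODE 00 Stage ₈a's named rows G₈a-1 ∧ G₈a-3 (`Node00.UkExists`,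
# `UkInSpaceB11`-diagonal), for the one-scale member `U_k(·) = Node00.Uk F N K k ε₀`; then the p. 193 mechanism COMPOSED at that
# instance — the N07 → N12 → N21 junction

Track A of `YM-PLAN.md` (cell `pub-ymgap`, HUMAN RULING D-0062), node **N21**, fan-out row s1 (director-ym R134, dag-lead FAN-OUT v1.1 §N21);
seat `pub-ymgap-dag-n21-c`, generation 0, file 1.  Kernel bookkeeping BY NAME over LANDED modules only: n21-b's
`Literature/…/B15Chi175LargeFieldFactor.lean` (p409091; the printed mechanism *«1 − χ_{k,Λ} is a large field function»* composed at field
level, CONDITIONAL on ONE binder `hreg`), n07-a's `Literature/…/B11Thm1CarrierT.lean` + `B11Thm1CarrierTLevelZero.lean` ([Balaban1985Variational]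
Theorem 1's carrier READ AT NODE 00's objects, readings D-n07a-1 «critical ↦ minimal» ∕ D-n07a-2; `objects_of_thm1Printed`), node00-def-B's
`Node00/BackgroundActionOfRecord.lean` (₈a: `Uk`, `UkExists`, `bgReg`) and n01-b's `Node00/BackgroundCurrentShape.lean` (`InUkClassB11`,
`UkInSpaceB11`).  0 `def`, 0 `sorry`, standard axioms.  COUNT-NEUTRAL; `--supports` the K3 item `SpineGivenEndpointR11`.

WHY THIS FILE (the row, read precisely).  The ONE CALL of record for (M1) at the live levels
(`ShellMeasureLiveEndOneCallUnionLevelsCfLinJunction.shellWeightBound_live_oneCall_union_levels_cfB7_lin_junction`, p241094) has NO hypothesis of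
[B15]-p.193 species (its wall-proper rows are the eleven statement types E1–E11 of the crew census `t4/b2b-balaban-t4-ne7c-p1/ONECALL-CENSUS-NE7c.md`
§13 — propagators, sectioned term pairs, readings; the first wall-proper binder in signature order is `hANN`, E11, [B11] Prop. 9 TYPE).  The
[B15] p. 193 TEMPLATE (`B15Chi175LargeFieldFactor` §1∕§3∕§5) carries exactly ONE undischarged binder, the REGULARITY TRANSFER
`hreg : ∀ W δ, 0 < δ → δ ≤ δ₀ → PlaqSmallOn allP δ W → ∀ p ∈ S, dev W p < B·δ·η²` — print ([IV] p. 193): *«The corresponding configuration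
U_{k,Z} satisfies the condition |∂U_{k,Z} − 1| < O(1)B₃M²εη²»* — i.e. [Balaban1985Variational] Theorem 1 read for the minimiser `dev`; n21-b's verdict
of record (WALK-N21 §3∕§4, 2026-08-25): «needs the interpreted [B11] family at `Setup`'s torus objects — object work».  That interpreted family
has since LANDED (`B11Thm1CarrierT.varProblemT`, 2026-08-26), so the binder is now dischargeable BY NAME — this file does it.

WHAT IS PROVED ([folklore] compositions; `η_k := (F.P K).eta k = L^{−k}`, `U_k(W) := Node00.Uk F N K k ε₀ W` = ₈a's minimiser of record of the
ONE-SCALE problem (0.21) over the plaquette class `bgReg(ε₀)`).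
* §1 THE TRANSFER.  `plaqSmall_of_orbitRel` (plaquette smallness is constant on residual gauge orbits); `plaqSmall_minimiser_of_thm1_objects`:
  from Theorem 1 AT OBJECTS for the member `(K, k)` — the sentence `objects_of_thm1Printed` unfolds `B11.Thm1Printed` to: (8) a minimiser over
  `𝔘_k(B₃ε₁) ∩ {Ū^k = V}` exists for `ε₁`-regular `V`, `0 < ε₁ ≤ a₁`, and (6) for `B₃ε₁ ≤ ε₀ ≤ a₀` every minimiser over `𝔘_k(ε₀) ∩ {Ū^k = V}` is a
  residual-gauge transform of it — EVERY minimiser over the (2)-class at `ε₀` satisfies `|U(∂p) − 1| < B₃ε₁η_k²` (δ-LINEAR in the datum's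
  regularity; only (8)-membership, (6) and the gauge invariance of `dist1 ∘ plaqHol` are consumed — NOT the regularity clause (9)–(10), NOT the
  current clause); `plaqSmall_Uk_of_thm1_objects`: the same for the minimiser OF RECORD `U_k(W)`, under ₈a's rows for regular data «the level-`k`
  problem over `bgReg(ε₀)` is solvable (G₈a-1 `UkExists`) and its solution of record lies in [B11] (2)'s space at `ε₀` (G₈a-3 diagonal)» — F7's
  formal direction (`B11Thm1CarrierT.isBackground_of_subset_of_mem`); **`hreg_Uk_of_thm1_objects`**: LITERALLY p409091's binder shape at
  `dev W p := dist1 (plaqHol (U_k(W)) p)`, `B := B₃`, `η := η_k`, `allP := univ`, ceiling `δ₀ := min a₁ (ε₀∕B₃)`.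
* §2 THE TEMPLATE COMPOSED AT THE INSTANCE (`B15Chi175LargeFieldFactor` BY NAME, `G = SU(N)`, `c_G = 2N`): the (2.17)-type slot
  ([Balaban1988Convergent] p. 257, background tested directly): `exists_large_plaquette_of_Uk_dev_ge` (a `θ`-large plaquette of `U_k(V)` on `S` forces a
  `B₃⁻¹η_k⁻²θ`-large plaquette of `V`), `exp_neg_wilsonLoc_le_of_Uk_dev_ge`, `largeInd_mul_exp_neg_wilsonLoc_le_of_Uk_dev_ge` and
  `largeInd_sup_mul_exp_neg_wilsonLoc_le_of_thm1_objects` (the slot variable `sup_{p ∈ S}|U_k(V)(∂p) − 1|` at a LOWERED threshold `θ` carries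
  `exp(−w(2N)⁻¹(B₃⁻¹η_k⁻²θ)²)` — NE7c's in-edge «N12 per-slot single-run large-field factor», now modulo N07's slot + ₈a's rows ONLY); the (1.75) form
  for print's `Λ` = a parallelepiped (`d = 4`, `B15ShellGauge193.extension193_shell_box` inside): `exists_large_plaquette_box_Uk`,
  `largeInd_mul_exp_neg_wilsonLoc_le_box_Uk`.
* §3 `hreg_Uk_of_thm1Printed`: §1's binder from `B11.Thm1Printed` over ANY family of T-carriers (constants existential, chosen before the member).
* §4 VACUITY GUARD (lineage audit A1–A6): the hypothesis set of §1–§2 is JOINTLY INHABITED at every member `(K, 0)` with `B₃ = 7` —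
  `thm1_objects_levelZero'` (Theorem 1 at objects, level 0: n07-a's `exists8_levelZero`∕`unique6_levelZero` in the unfolded currency),
  `ukRows_levelZero` (₈a's G₈a-1 ∧ G₈a-3-diagonal at level 0 for regular data: `Node00.ukExists_zero_iff`, `Uk_zero`,
  `B11Thm1LevelZero.inUkClassB11_zero_of_plaqSmall`), `hreg_Uk_levelZero` (the junction FIRES), `hreg_Uk_levelZero_flat` (and is met by the flat datum
  with a strict inequality to spare — not an empty range).

HONEST FRAMING.  A junction BY NAME; nothing of Bałaban's is asserted: N07's Theorem-1 slot (`B11.Thm1Printed` at the T-carrier family, levels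
`k ≥ 1` = Bałaban's theorem, proved nowhere in the tree) and ₈a's rows G₈a-1∕G₈a-3 stay DISPLAYED hypotheses.  SCOPE (located, not claimed): `U_k`
here is the ONE-SCALE member `Ω_j = T` of the (2.12) solution map (the no-large-field case, `Node00.LargeFieldBackgroundOfRecord`
`genSet_eq_atScale_of_top` ∕ `mem_solvableDom_top_iff_ukExists`); print's `U_{k,Z}` of (1.74) for a general large-field region `Z` is the multi-scale
member, whose Theorem-1 carrier (`{Ω_j}` with holes) is not yet read at objects — the same junction applies verbatim the hour it is.  (M1)
`SlotAntiConcentration`, `ShellWeightBound` (NE7c) untouched: NE7c is NOT PRINTED and NOT PROVED; the count × suppression wall of `T4ShellCount`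
§2 stands (a pointwise factor is not a summable relative weight).  One finite four-torus at fixed `ε`; nothing continuum ∕ ℝ⁴ ∕ OS ∕ mass-gap ∕ Clay.
-/

set_option autoImplicit false

noncomputable section

namespace Summit.QuantumFields.YangMills.Theorems.N21RegularityTransferJunction

open Literature.MathematicalPhysics.QuantumFieldTheory.Balaban1983to89
open T4Continuum (T4Family)
open B12GaugeOrbits021 (OrbitRel)
open Node00 (SU avOfRecord bgReg InUkClassB11 UkExists Uk)
open B11Thm1CarrierT (RegCarrierT varProblemT isBackground_of_subset_of_mem)
open B11Thm1CarrierTLevelZero (inUkClassB11_mono)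
open B11Thm1LevelZero (isBackground_zero_iff inUkClassB11_zero_of_plaqSmall)
open GaugeField (plaqHol gaugeAct)
open B15.PrelimIntegrations (Chi175)
open B15Extension193 (outBonds outPlaqs boxSites)
open B16Sect1Wilson (wilsonLoc)
open T4IndicatorShell (largeInd)
open B15Chi175LargeFieldFactor (exists_large_plaquette_of_dev_ge exp_neg_wilsonLoc_le_of_dev_ge exists_large_plaquette_box
  largeInd_mul_exp_neg_wilsonLoc_le_box_specialUnitary hcmp_specialUnitaryGroup)

variable {F : T4Family} {N : ℕ} [NeZero N]

/-! ## §0. Two elementary facts about the plaquette class -/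

omit [NeZero N] in
/-- `η_k = L^{−k} > 0`. [folklore] -/
theorem eta_pos (K k : ℕ) : 0 < (F.P K).eta k :=
  pow_pos (inv_pos.mpr (Nat.cast_pos.mpr (F.P K).L_pos)) k

/-- `PlaqSmallOn univ δ` IS `PlaqSmall δ` (the `allP := univ` reading of p409091's binder for the one-scale member). [folklore] -/
theorem plaqSmall_of_plaqSmallOn_univ {P : Params} {G : Type*} [GaugeGroup G] {j : ℕ} {δ : ℝ} {U : GaugeField P j G}
    (h : PlaqSmallOn Set.univ δ U) : PlaqSmall δ U :=
  fun p => h p (Set.mem_univ p)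

/-- **Plaquette smallness is constant on residual gauge orbits** (`|U^u(∂p) − 1| = |U(∂p) − 1|`, `B12GaugeOrbits021.plaqSmall_gaugeAct_iff'`
BY NAME): the only transport the transfer needs. [folklore] -/
theorem plaqSmall_of_orbitRel {K k : ℕ} {δ : ℝ} {U U' : GaugeField (F.P K) 0 (SU N)} (h : OrbitRel k U U')
    (hU : PlaqSmall δ U) : PlaqSmall δ U' := by
  obtain ⟨u, -, rfl⟩ := h
  exact (B12GaugeOrbits021.plaqSmall_gaugeAct_iff' δ u U).2 hU

/-- `2N > 0` — the `SU(N)` comparison constant `c_G = 2N` of `|g − 1|² ≤ c_G(1 − Re tr g)` is positive. [folklore] -/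
theorem two_mul_N_pos : (0 : ℝ) < 2 * (N : ℝ) := by
  have : (0 : ℝ) < N := by exact_mod_cast Nat.pos_of_ne_zero (NeZero.ne N)
  linarith

omit [NeZero N] in
/-- An indicator times a nonnegative quantity is below `Y ≥ 0` once the bound holds ON the indicated event. [folklore] -/
theorem largeInd_mul_le_of {u θ X Y : ℝ} (hY : 0 ≤ Y) (h : θ ≤ u → X ≤ Y) : largeInd u θ * X ≤ Y := by
  unfold largeInd
  split_ifs with hu
  · rw [one_mul]; exact h hu
  · rw [zero_mul]; exact hY

/-! ## §1. The δ-linear regularity transfer of the minimiser from Theorem 1 read at objects -/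

section Thm1Objects

variable {K k : ℕ} {a₀ a₁ B₃ : ℝ}

/- THEOREM 1 AT OBJECTS for the member `(K, k)` — VERBATIM the per-member body of n07-a's `B11Thm1CarrierT.objects_of_thm1Printed`
((8) existence in `𝔘_k(B₃ε₁)`, (6) uniqueness in `𝔘_k(ε₀)` read «critical ↦ minimal», D-n07a-1); a DISPLAYED hypothesis, N07's slot. -/
variable (hT1 : ∀ ε₁ : ℝ, 0 < ε₁ → ε₁ ≤ a₁ → ∀ V : GaugeField (F.P K) k (SU N), PlaqSmall ε₁ V →
    (∃ U : GaugeField (F.P K) 0 (SU N),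
        IsBackground (avOfRecord F N K) {U | InUkClassB11 F N K k (B₃ * ε₁) U} k V U) ∧
    (∀ ε₀ : ℝ, B₃ * ε₁ ≤ ε₀ → ε₀ ≤ a₀ → ∀ U U' : GaugeField (F.P K) 0 (SU N),
        IsBackground (avOfRecord F N K) {U | InUkClassB11 F N K k (B₃ * ε₁) U} k V U →
        IsBackground (avOfRecord F N K) {U | InUkClassB11 F N K k ε₀ U} k V U' →
          InUkClassB11 F N K k ε₀ U ∧ OrbitRel k U U'))

include hT1

/-- **THE TRANSFER FOR ANY MINIMISER OVER THE (2)-CLASS AT `ε₀`.**  Theorem 1 at objects for the member `(K, k)`, `0 < ε₁ ≤ a₁`,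
`B₃ε₁ ≤ ε₀ ≤ a₀`, a datum `V` with (7) `|V(∂p) − 1| < ε₁`: every minimiser `U′` of the Wilson action over `𝔘_k(ε₀) ∩ {Ū^k = V}` satisfies
`|U′(∂p) − 1| < B₃ε₁η_k²` for ALL plaquettes — (8) puts the small-class minimiser in `𝔘_k(B₃ε₁) ⊆ bgReg(B₃ε₁)` (`Node00.InUkClassB11.mem_bgReg`),
(6) puts `U′` on its residual orbit, and plaquette smallness is orbit-constant.  Print's first p. 193 sentence for `U_{k,Z}`, δ-LINEAR in the
datum's regularity. [folklore] -/
theorem plaqSmall_minimiser_of_thm1_objects {ε₁ ε₀ : ℝ} (hε₁ : 0 < ε₁) (hε₁a : ε₁ ≤ a₁) (hlo : B₃ * ε₁ ≤ ε₀) (hhi : ε₀ ≤ a₀)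
    {V : GaugeField (F.P K) k (SU N)} (hV : PlaqSmall ε₁ V) {U' : GaugeField (F.P K) 0 (SU N)}
    (hU' : IsBackground (avOfRecord F N K) {U | InUkClassB11 F N K k ε₀ U} k V U') :
    PlaqSmall (B₃ * ε₁ * (F.P K).eta k ^ 2) U' := by
  obtain ⟨⟨U, hU⟩, huniq⟩ := hT1 ε₁ hε₁ hε₁a V hV
  have hUreg : U ∈ bgReg F N K k (B₃ * ε₁) := Node00.InUkClassB11.mem_bgReg hU.2.1
  exact plaqSmall_of_orbitRel (huniq ε₀ hlo hhi U U' hU hU').2 ((Node00.mem_bgReg_iff F N K k _ U).1 hUreg)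

variable {ε₀ : ℝ}

/- NODE 00 Stage ₈a's rows G₈a-1 ∧ G₈a-3 (diagonal) FOR REGULAR DATA at the class radius `ε₀` — «the level-`k` problem (0.21) over `bgReg(ε₀)`
is solvable at `V` and its solution of record `U_k(V)` lies in [B11] (2)'s space `𝔘_k(ε₀)`» (`Node00.UkExists`, `Node00.UkInSpaceB11`'s body);
a DISPLAYED hypothesis, asserted by nobody (print: [B11] Thm 1 (8) + [I] p. 260 «implied by the condition on V … see Theorem 1 [15]»). -/
variable (hUk : ∀ (V : GaugeField (F.P K) k (SU N)) (δ : ℝ), 0 < δ → δ ≤ a₁ → B₃ * δ ≤ ε₀ → PlaqSmall δ V →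
    UkExists F N K k ε₀ V ∧ InUkClassB11 F N K k ε₀ (Uk F N K k ε₀ V))

include hUk

/-- **THE TRANSFER FOR THE MINIMISER OF RECORD `U_k(W) = Node00.Uk F N K k ε₀ W`.**  For `δ`-regular `W` (`0 < δ ≤ a₁`, `B₃δ ≤ ε₀ ≤ a₀`):
`|U_k(W)(∂p) − 1| < B₃δη_k²` for every plaquette.  ₈a's minimiser minimises over the LARGER plaquette class `bgReg(ε₀)`; lying in the (2)-class
at `ε₀` (G₈a-3) it minimises over it (F7, `isBackground_of_subset_of_mem`), and §1's transfer applies. [folklore] -/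
theorem plaqSmall_Uk_of_thm1_objects (hhi : ε₀ ≤ a₀) {δ : ℝ} (hδ : 0 < δ) (hδa : δ ≤ a₁) (hδε : B₃ * δ ≤ ε₀)
    {W : GaugeField (F.P K) k (SU N)} (hW : PlaqSmall δ W) :
    PlaqSmall (B₃ * δ * (F.P K).eta k ^ 2) (Uk F N K k ε₀ W) := by
  obtain ⟨hG1, hG3⟩ := hUk W δ hδ hδa hδε hW
  have hmin : IsBackground (avOfRecord F N K) {U | InUkClassB11 F N K k ε₀ U} k W (Uk F N K k ε₀ W) :=
    isBackground_of_subset_of_mem (Node00.isBackground_Uk hG1) (fun _ hU => Node00.InUkClassB11.mem_bgReg hU) hG3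
  exact plaqSmall_minimiser_of_thm1_objects hT1 hδ hδa hδε hhi hW hmin

/-- **`hreg` OF `B15Chi175LargeFieldFactor` AT THE MINIMISER OF RECORD — LITERALLY THE BINDER's SHAPE** (p409091 §1∕§3∕§5:
`∀ W δ, 0 < δ → δ ≤ δ₀ → PlaqSmallOn allP δ W → ∀ p ∈ S, dev W p < B·δ·η²`) with `dev W p := dist1 (plaqHol (U_k(W)) p)`, `B := B₃`, `η := η_k`,
`allP := univ`, the ceiling `δ₀ := min a₁ (ε₀∕B₃)` (print's *«ε > 0 is sufficiently small»*), ANY background plaquette range `S`.  CONDITIONAL on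
N07's Theorem-1 slot at the member and ₈a's rows for regular data; nothing of Bałaban's asserted. [folklore] -/
theorem hreg_Uk_of_thm1_objects (hB₃ : 0 < B₃) (hhi : ε₀ ≤ a₀) (S : Set (Plaq (F.P K) 0)) :
    ∀ (W : GaugeField (F.P K) k (SU N)) (δ : ℝ), 0 < δ → δ ≤ min a₁ (ε₀ / B₃) → PlaqSmallOn Set.univ δ W →
      ∀ p ∈ S, dist1 (plaqHol (Uk F N K k ε₀ W) p) < B₃ * δ * (F.P K).eta k ^ 2 := by
  intro W δ hδ hδ₀ hW p _
  have hδa : δ ≤ a₁ := hδ₀.trans (min_le_left _ _)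
  have hδε : B₃ * δ ≤ ε₀ := by
    have h := hδ₀.trans (min_le_right _ _)
    rw [le_div_iff₀ hB₃] at h
    linarith
  exact plaqSmall_Uk_of_thm1_objects hT1 hUk hhi hδ hδa hδε (plaqSmall_of_plaqSmallOn_univ hW) p

/-! ## §2. The [B15] p. 193 template COMPOSED at the instance (`B15Chi175LargeFieldFactor` BY NAME, `G = SU(N)`) -/

/-- **THE (2.17)-TYPE SLOT, LARGE-FIELD SIDE** ([Balaban1988Convergent] p. 257: the background `U_k(V)` tested directly; p409091's
`exists_large_plaquette_of_dev_ge` at the instance): if `U_k(V)` has a plaquette `p ∈ S` with `|U_k(V)(∂p) − 1| ≥ θ > 0`, and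
`B₃⁻¹η_k⁻²θ` is below the ceiling, then the DATUM `V` has a plaquette `p′` with `|V(∂p′) − 1| ≥ B₃⁻¹η_k⁻²θ` — the bare contrapositive of
the transfer, now modulo N07's slot + ₈a's rows only. [folklore] -/
theorem exists_large_plaquette_of_Uk_dev_ge (hB₃ : 0 < B₃) (hhi : ε₀ ≤ a₀) (S : Set (Plaq (F.P K) 0)) {θ : ℝ} (hθ : 0 < θ)
    (hθw : B₃⁻¹ * ((F.P K).eta k ^ 2)⁻¹ * θ ≤ min a₁ (ε₀ / B₃)) {V : GaugeField (F.P K) k (SU N)}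
    (hlarge : ∃ p ∈ S, θ ≤ dist1 (plaqHol (Uk F N K k ε₀ V) p)) :
    ∃ p : Plaq (F.P K) k, B₃⁻¹ * ((F.P K).eta k ^ 2)⁻¹ * θ ≤ dist1 (plaqHol V p) := by
  obtain ⟨p, -, hp⟩ := exists_large_plaquette_of_dev_ge (D := Set.univ) hB₃ (eta_pos K k) hθ
    (fun W p => dist1 (plaqHol (Uk F N K k ε₀ W) p)) S (hreg_Uk_of_thm1_objects hT1 hUk hB₃ hhi S) hθw hlarge
  exact ⟨p, hp⟩

/-- **… AND THE WILSON FACTOR** (*«estimating in the usual way the Wilson action»*, p409091's `exp_neg_wilsonLoc_le_of_dev_ge` at the instance,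
`|g − 1|² ≤ 2N(1 − Re tr g)` on `SU(N)`): for a plaquette weight `ζ ≥ w` everywhere (`ζ` = the coupling profile times a cut-off), a `θ`-large
background plaquette on `S` gives `exp(−A(ζ, V)) ≤ exp(−w·(2N)⁻¹·(B₃⁻¹η_k⁻²θ)²)`. [folklore] -/
theorem exp_neg_wilsonLoc_le_of_Uk_dev_ge (hB₃ : 0 < B₃) (hhi : ε₀ ≤ a₀) (S : Set (Plaq (F.P K) 0)) {θ : ℝ} (hθ : 0 < θ)
    (hθw : B₃⁻¹ * ((F.P K).eta k ^ 2)⁻¹ * θ ≤ min a₁ (ε₀ / B₃)) (ζ : Plaq (F.P K) k → ℝ) (hζ : ∀ p, 0 ≤ ζ p) {w : ℝ}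
    (hw : ∀ p, w ≤ ζ p) {V : GaugeField (F.P K) k (SU N)} (hlarge : ∃ p ∈ S, θ ≤ dist1 (plaqHol (Uk F N K k ε₀ V) p)) :
    Real.exp (-wilsonLoc ζ V) ≤ Real.exp (-(w * ((2 * (N : ℝ))⁻¹ * (B₃⁻¹ * ((F.P K).eta k ^ 2)⁻¹ * θ) ^ 2))) :=
  exp_neg_wilsonLoc_le_of_dev_ge (D := Set.univ) hB₃ (eta_pos K k) hθ (fun W p => dist1 (plaqHol (Uk F N K k ε₀ W) p)) S
    (hreg_Uk_of_thm1_objects hT1 hUk hB₃ hhi S) hθw hcmp_specialUnitaryGroup two_mul_N_pos ζ hζ (fun p _ => hw p) hlarge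

/-- **THE SINGLE-RUN LARGE-FIELD FACTOR OF A `U_k`-MEDIATED SLOT AT A LOWERED THRESHOLD** (indicator currency of `T4IndicatorShell`, NE7c's
in-edge «N12 per-slot factor»): for any tested variable `u` of the slot whose large-field event `{θ ≤ u}` forces a `θ`-large background plaquette
on `S`, `1[θ ≤ u]·exp(−A(ζ, V)) ≤ exp(−w·(2N)⁻¹·(B₃⁻¹η_k⁻²θ)²)` — `θ` is FREE below the ceiling (a live threshold `(1 − ρ)·ε_kη_k²` included).
CONDITIONAL on N07's slot + ₈a's rows; NOT `ShellWeightBound`. [folklore] -/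
theorem largeInd_mul_exp_neg_wilsonLoc_le_of_Uk_dev_ge (hB₃ : 0 < B₃) (hhi : ε₀ ≤ a₀) (S : Set (Plaq (F.P K) 0)) {θ : ℝ}
    (hθ : 0 < θ) (hθw : B₃⁻¹ * ((F.P K).eta k ^ 2)⁻¹ * θ ≤ min a₁ (ε₀ / B₃)) (ζ : Plaq (F.P K) k → ℝ) (hζ : ∀ p, 0 ≤ ζ p)
    {w : ℝ} (hw : ∀ p, w ≤ ζ p) {V : GaugeField (F.P K) k (SU N)} {u : ℝ}
    (hu : θ ≤ u → ∃ p ∈ S, θ ≤ dist1 (plaqHol (Uk F N K k ε₀ V) p)) :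
    largeInd u θ * Real.exp (-wilsonLoc ζ V) ≤
      Real.exp (-(w * ((2 * (N : ℝ))⁻¹ * (B₃⁻¹ * ((F.P K).eta k ^ 2)⁻¹ * θ) ^ 2))) :=
  largeInd_mul_le_of (Real.exp_pos _).le fun h =>
    exp_neg_wilsonLoc_le_of_Uk_dev_ge hT1 hUk hB₃ hhi S hθ hθw ζ hζ hw (hu h)

/-- **THE (2.17) SLOT VARIABLE ITSELF**: `u := sup_{p ∈ S}|U_k(V)(∂p) − 1|` over a nonempty finite plaquette set `S` (print's
*«sup_{p ⊂ □∼}|U_{k,□}(V_k, ∂p) − 1|»* for the one-scale member) — its large-field indicator at ANY threshold `θ` below the ceiling times the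
Wilson factor is `≤ exp(−w·(2N)⁻¹·(B₃⁻¹η_k⁻²θ)²)` (`Finset.le_sup'_iff`). [folklore] -/
theorem largeInd_sup_mul_exp_neg_wilsonLoc_le_of_thm1_objects (hB₃ : 0 < B₃) (hhi : ε₀ ≤ a₀) (S : Finset (Plaq (F.P K) 0))
    (hS : S.Nonempty) {θ : ℝ} (hθ : 0 < θ) (hθw : B₃⁻¹ * ((F.P K).eta k ^ 2)⁻¹ * θ ≤ min a₁ (ε₀ / B₃)) (ζ : Plaq (F.P K) k → ℝ)
    (hζ : ∀ p, 0 ≤ ζ p) {w : ℝ} (hw : ∀ p, w ≤ ζ p) (V : GaugeField (F.P K) k (SU N)) :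
    largeInd (S.sup' hS fun p => dist1 (plaqHol (Uk F N K k ε₀ V) p)) θ * Real.exp (-wilsonLoc ζ V) ≤
      Real.exp (-(w * ((2 * (N : ℝ))⁻¹ * (B₃⁻¹ * ((F.P K).eta k ^ 2)⁻¹ * θ) ^ 2))) :=
  largeInd_mul_exp_neg_wilsonLoc_le_of_Uk_dev_ge hT1 hUk hB₃ hhi (↑S) hθ hθw ζ hζ hw fun h => by
    obtain ⟨p, hp, hle⟩ := (Finset.le_sup'_iff hS).1 h
    exact ⟨p, Finset.mem_coe.2 hp, hle⟩

/-- **THE (1.75) FORM FOR PRINT's `Λ` = A PARALLELEPIPED** (p409091's `exists_large_plaquette_box` at the instance; `d = 4` by `T4Family.P_d`, the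
extension property is `B15ShellGauge193.extension193_shell_box`, `C = 48d + 1`): if `χ_{k,Λ}(V) = 0` at the (live) threshold `2ε′η_k²` — every
extension `W` of `V` off the bonds of the box has a background plaquette `p ∈ S` with `|U_k(W)(∂p) − 1| ≥ 2ε′η_k²` — then `V` has a plaquette `p′`
outside the box with `|V(∂p′) − 1| ≥ ((48d+1)·B₃·M²)⁻¹ε′`.  Print's second p. 193 sentence, modulo N07's slot + ₈a's rows only. [folklore] -/
theorem exists_large_plaquette_box_Uk (hB₃ : 0 < B₃) (hhi : ε₀ ≤ a₀) (S : Set (Plaq (F.P K) 0)) {lo hi : Fin (F.P K).d → ℤ}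
    (hlohi : lo ≤ hi) {n : ℕ} (hn : ∀ κ, hi κ ≤ lo κ + n) (hN : ∀ κ, hi κ - lo κ + 3 < ((F.P K).sitesPerDir k : ℤ)) {M : ℝ}
    (hM : (n : ℝ) + 1 ≤ M) {ε' : ℝ} (hε' : 0 < ε') (hε'w : B₃⁻¹ * ε' ≤ min a₁ (ε₀ / B₃)) {V : GaugeField (F.P K) k (SU N)}
    (hV : ¬ Chi175 (fun (e : {W : GaugeField (F.P K) k (SU N) // ∀ b ∈ outBonds (boxSites lo hi), W b = V b})
      (p : Plaq (F.P K) 0) => dist1 (plaqHol (Uk F N K k ε₀ e.1) p)) S ε' ((F.P K).eta k)) :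
    ∃ p ∈ outPlaqs (boxSites (k := k) lo hi), ((48 * ((F.P K).d : ℝ) + 1) * B₃ * M ^ 2)⁻¹ * ε' ≤ dist1 (plaqHol V p) := by
  have hd : 3 ≤ (F.P K).d := by rw [T4Family.P_d]; norm_num
  exact exists_large_plaquette_box hd hlohi hn hN hM hB₃ hε' (fun W p => dist1 (plaqHol (Uk F N K k ε₀ W) p)) S
    (hreg_Uk_of_thm1_objects hT1 hUk hB₃ hhi S) hε'w hV

/-- **THE WHOLE p. 193 CHAIN AT THE INSTANCE** (p409091's `largeInd_mul_exp_neg_wilsonLoc_le_box_specialUnitary`): `G = SU(N)`, `Λ` a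
parallelepiped, weight `ζ ≥ 0` with `ζ ≥ w` on the plaquettes outside the box — the single-run large-field indicator of the `χ_{k,Λ}`-slot at the
lowered threshold `2ε′η_k²` times the Wilson factor is `≤ exp(−w·(2N)⁻¹·(((48d+1)·B₃·M²)⁻¹ε′)²)`.  CONDITIONAL on N07's Theorem-1 slot at the
member and ₈a's rows for regular data — the binder `hreg` of the template is GONE; NOT `ShellWeightBound`. [folklore] -/
theorem largeInd_mul_exp_neg_wilsonLoc_le_box_Uk (hB₃ : 0 < B₃) (hhi : ε₀ ≤ a₀) (S : Set (Plaq (F.P K) 0))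
    {lo hi : Fin (F.P K).d → ℤ} (hlohi : lo ≤ hi) {n : ℕ} (hn : ∀ κ, hi κ ≤ lo κ + n)
    (hN : ∀ κ, hi κ - lo κ + 3 < ((F.P K).sitesPerDir k : ℤ)) {M : ℝ} (hM : (n : ℝ) + 1 ≤ M) {ε' w : ℝ} (hε' : 0 < ε')
    (hε'w : B₃⁻¹ * ε' ≤ min a₁ (ε₀ / B₃)) (ζ : Plaq (F.P K) k → ℝ) (hζ : ∀ p, 0 ≤ ζ p)
    (hw : ∀ p ∈ outPlaqs (boxSites (k := k) lo hi), w ≤ ζ p) {V : GaugeField (F.P K) k (SU N)} {u : ℝ}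
    (hu : 2 * ε' * (F.P K).eta k ^ 2 ≤ u → ¬ Chi175 (fun (e : {W : GaugeField (F.P K) k (SU N) //
      ∀ b ∈ outBonds (boxSites lo hi), W b = V b}) (p : Plaq (F.P K) 0) => dist1 (plaqHol (Uk F N K k ε₀ e.1) p)) S ε'
      ((F.P K).eta k)) :
    largeInd u (2 * ε' * (F.P K).eta k ^ 2) * Real.exp (-wilsonLoc ζ V) ≤
      Real.exp (-(w * ((2 * (N : ℝ))⁻¹ * (((48 * ((F.P K).d : ℝ) + 1) * B₃ * M ^ 2)⁻¹ * ε') ^ 2))) := by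
  have hd : 3 ≤ (F.P K).d := by rw [T4Family.P_d]; norm_num
  exact largeInd_mul_exp_neg_wilsonLoc_le_box_specialUnitary hd hlohi hn hN hM hB₃ hε'
    (fun W p => dist1 (plaqHol (Uk F N K k ε₀ W) p)) S (hreg_Uk_of_thm1_objects hT1 hUk hB₃ hhi S) hε'w ζ hζ hw hu

end Thm1Objects

/-! ## §3. From `B11.Thm1Printed` over a family of T-carriers -/

/-- **`hreg` AT THE MINIMISER OF RECORD FROM N07's THEOREM-1 SLOT OVER A FAMILY** (`B11Thm1CarrierT.objects_of_thm1Printed` BY NAME): for any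
index (members = approximations `K i`, levels `k i`, residual regularity data `R i`), `B11.Thm1Printed` over the family of T-carriers gives
constants `a₀, a₁, B₃ > 0`, `B₃a₁ ≤ a₀`, chosen BEFORE the member, such that at every member and every class radius `ε₀ ≤ a₀` at which ₈a's rows
hold for regular data, p409091's binder holds for `U_{k i}` with `B := B₃`, ceiling `min a₁ (ε₀∕B₃)`. [folklore] -/
theorem hreg_Uk_of_thm1Printed {I : Type} (Kof kof : I → ℕ) (R : ∀ i, RegCarrierT F N (Kof i))
    (h : B11.Thm1Printed (fun i => varProblemT F N (Kof i) (kof i) (R i))) :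
    ∃ a₀ a₁ B₃ : ℝ, 0 < a₀ ∧ 0 < a₁ ∧ 0 < B₃ ∧ B₃ * a₁ ≤ a₀ ∧
      ∀ (i : I) (ε₀ : ℝ), ε₀ ≤ a₀ →
        (∀ (V : GaugeField (F.P (Kof i)) (kof i) (SU N)) (δ : ℝ), 0 < δ → δ ≤ a₁ → B₃ * δ ≤ ε₀ → PlaqSmall δ V →
            UkExists F N (Kof i) (kof i) ε₀ V ∧ InUkClassB11 F N (Kof i) (kof i) ε₀ (Uk F N (Kof i) (kof i) ε₀ V)) →
        ∀ (S : Set (Plaq (F.P (Kof i)) 0)) (W : GaugeField (F.P (Kof i)) (kof i) (SU N)) (δ : ℝ), 0 < δ →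
          δ ≤ min a₁ (ε₀ / B₃) → PlaqSmallOn Set.univ δ W →
            ∀ p ∈ S, dist1 (plaqHol (Uk F N (Kof i) (kof i) ε₀ W) p) < B₃ * δ * (F.P (Kof i)).eta (kof i) ^ 2 := by
  obtain ⟨a₀, a₁, B₃, ha₀, ha₁, hB₃, hle, H⟩ := B11Thm1CarrierT.objects_of_thm1Printed Kof kof R h
  exact ⟨a₀, a₁, B₃, ha₀, ha₁, hB₃, hle, fun i ε₀ hhi hUk S => hreg_Uk_of_thm1_objects (H i) hUk hB₃ hhi S⟩

/-! ## §4. Vacuity guard: the hypothesis set is jointly inhabited at every member `(K, 0)` (`B₃ = 7`) -/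

/-- **THEOREM 1 AT OBJECTS, LEVEL 0, IN THE UNFOLDED CURRENCY OF §1** (`B₃ = 7`, ANY `a₀`, `a₁`): at `k = 0` a minimal configuration IS the
datum (`B11Thm1LevelZero.isBackground_zero_iff`), which lies in `𝔘_0(7ε₁)` (`inUkClassB11_zero_of_plaqSmall`) — n07-a's `exists8_levelZero` ∕
`unique6_levelZero` restated without the carrier's residual data.  The trivial level only. [folklore] -/
theorem thm1_objects_levelZero' (K : ℕ) (a₀ a₁ : ℝ) :
    ∀ ε₁ : ℝ, 0 < ε₁ → ε₁ ≤ a₁ → ∀ V : GaugeField (F.P K) 0 (SU N), PlaqSmall ε₁ V →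
      (∃ U : GaugeField (F.P K) 0 (SU N),
          IsBackground (avOfRecord F N K) {U | InUkClassB11 F N K 0 (7 * ε₁) U} 0 V U) ∧
      (∀ ε₀ : ℝ, 7 * ε₁ ≤ ε₀ → ε₀ ≤ a₀ → ∀ U U' : GaugeField (F.P K) 0 (SU N),
          IsBackground (avOfRecord F N K) {U | InUkClassB11 F N K 0 (7 * ε₁) U} 0 V U →
          IsBackground (avOfRecord F N K) {U | InUkClassB11 F N K 0 ε₀ U} 0 V U' →
            InUkClassB11 F N K 0 ε₀ U ∧ OrbitRel 0 U U') := by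
  intro ε₁ hε₁ _ V hV
  refine ⟨⟨V, (isBackground_zero_iff _ _ V V).2 ⟨rfl, inUkClassB11_zero_of_plaqSmall F N K hε₁ hV⟩⟩, ?_⟩
  intro ε₀ hlo _ U U' hU hU'
  obtain ⟨hUV, -⟩ := (isBackground_zero_iff _ _ V U).1 hU
  obtain ⟨hU'V, -⟩ := (isBackground_zero_iff _ _ V U').1 hU'
  subst hUV hU'V
  exact ⟨inUkClassB11_mono hlo (inUkClassB11_zero_of_plaqSmall F N K hε₁ hV), OrbitRel.refl 0 _⟩

/-- **₈a's ROWS G₈a-1 ∧ G₈a-3 (diagonal) AT LEVEL 0 FOR REGULAR DATA** (`B₃ = 7`): for `0 < δ`, `7δ ≤ ε₀` and a `δ`-regular datum the level-0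
problem over `bgReg(ε₀)` is solvable, its solution of record is the datum (`Node00.Uk_zero`) and lies in `𝔘_0(ε₀)`
(`inUkClassB11_zero_of_plaqSmall` + monotonicity). [folklore] -/
theorem ukRows_levelZero (K : ℕ) (a₁ ε₀ : ℝ) :
    ∀ (V : GaugeField (F.P K) 0 (SU N)) (δ : ℝ), 0 < δ → δ ≤ a₁ → 7 * δ ≤ ε₀ → PlaqSmall δ V →
      UkExists F N K 0 ε₀ V ∧ InUkClassB11 F N K 0 ε₀ (Uk F N K 0 ε₀ V) := by
  intro V δ hδ _ hδε hV
  have hε₀ : InUkClassB11 F N K 0 ε₀ V := inUkClassB11_mono hδε (inUkClassB11_zero_of_plaqSmall F N K hδ hV)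
  have hex : UkExists F N K 0 ε₀ V := Node00.ukExists_zero_iff.2 hε₀.mem_bgReg
  refine ⟨hex, ?_⟩
  rw [Node00.Uk_zero hex]
  exact hε₀

/-- **THE JUNCTION FIRES AT LEVEL 0** (vacuity guard): with `B₃ = 7` and any `0 < a₁`, `ε₀ ≤ a₀`, §1's `hreg` holds for `U_0` OUTRIGHT — its two
displayed hypotheses are theorems at the trivial level (`thm1_objects_levelZero'`, `ukRows_levelZero`).  Nothing about the levels `k ≥ 1`.
[folklore] -/
theorem hreg_Uk_levelZero (K : ℕ) {a₀ a₁ ε₀ : ℝ} (hhi : ε₀ ≤ a₀) (S : Set (Plaq (F.P K) 0)) :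
    ∀ (W : GaugeField (F.P K) 0 (SU N)) (δ : ℝ), 0 < δ → δ ≤ min a₁ (ε₀ / 7) → PlaqSmallOn Set.univ δ W →
      ∀ p ∈ S, dist1 (plaqHol (Uk F N K 0 ε₀ W) p) < 7 * δ * (F.P K).eta 0 ^ 2 :=
  hreg_Uk_of_thm1_objects (thm1_objects_levelZero' K a₀ a₁) (ukRows_levelZero K a₁ ε₀) (by norm_num) hhi S

/-- **… NON-VACUOUSLY**: the binder's own range is inhabited — at `a₀ = ε₀ = 7`, `a₁ = 1`, `δ = 1` the flat datum `W = 1` is `δ`-regular with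
`δ ≤ min a₁ (ε₀∕7)`, and the conclusion reads `|U_0(1)(∂p) − 1| < 7` for every `p`. [folklore] -/
theorem hreg_Uk_levelZero_flat (K : ℕ) (p : Plaq (F.P K) 0) :
    PlaqSmallOn Set.univ (1 : ℝ) (1 : GaugeField (F.P K) 0 (SU N)) ∧ (1 : ℝ) ≤ min (1 : ℝ) ((7 : ℝ) / 7) ∧
      dist1 (plaqHol (Uk F N K 0 (7 : ℝ) (1 : GaugeField (F.P K) 0 (SU N))) p) < 7 * 1 * (F.P K).eta 0 ^ 2 := by
  have hflat : PlaqSmallOn Set.univ (1 : ℝ) (1 : GaugeField (F.P K) 0 (SU N)) := by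
    intro q _
    have h1 : plaqHol (1 : GaugeField (F.P K) 0 (SU N)) q = 1 := by
      simp [GaugeField.plaqHol, show ∀ b : PBond (F.P K) 0, (1 : GaugeField (F.P K) 0 (SU N)) b = 1 from fun _ => rfl]
    rw [h1, GaugeGroup.dist1_one]
    exact one_pos
  have hmin : (1 : ℝ) ≤ min (1 : ℝ) ((7 : ℝ) / 7) := by norm_num
  exact ⟨hflat, hmin, hreg_Uk_levelZero K (a₀ := 7) (a₁ := 1) (ε₀ := 7) le_rfl Set.univ 1 1 one_pos hmin hflat p
    (Set.mem_univ p)⟩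

end Summit.QuantumFields.YangMills.Theorems.N21RegularityTransferJunction

end
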